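import Summits.HubbardSuperconductivity.HubbardSuperconductivity.Theorems.AnisotropyChordTransferLadderFlip
import Summits.HubbardSuperconductivity.HubbardSuperconductivity.Theorems.AnisotropyChordTransferBEC

/-!
# Route `AnisotropyChord` / H0 rotor rung, route (1): LEMMA E, step 3 — the DOUBLE-COMMUTATOR BOUND (involution) and LEMMA E / THEOREM T assembled
# `W⁺(b) + W⁻(b) ≤ (Σ_x Σ_y [x ∼ y])·Σ b²`, hence `LadderExcessBound` (LEMMA E) HOLDS
(prover seat `hubbard-h0-rotor-p1` g13; theory seat `hubbard-h0-rotor-theory-1` THEOREM-T.md «LEMMA E» (Koma–Tasaki double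
commutator), memo ROTOR-THEORY-11 §175)

With `W = Σ_bonds SᶻSᶻ` (`isingW`) and the local field `h_x = Σ_{y∼x} Sᶻ_y` (`hloc`): flipping `x` changes `W` by `±h_x`
(`isingW_sub_update_one`, `isingW_update_zero_sub`); by adjointness (`sum_mul_lowerSum_eq_sum_raiseSum_mul`)
`W⁺(b) = ⟨b, [S⁻,W] S⁺ b⟩`, `W⁻(b) = ⟨b, [S⁺,W] S⁻ b⟩` (`raiseCommW_eq`, `lowerCommW_eq`); expanding `S^±` gives a DIAGONAL part
`−4⟨b, W b⟩ ≤ ½(ΣΣ[∼])Σb²` and an OFF-DIAGONAL part which, symmetrised under `τ ↦ τ ∘ swap x x'`, localises on the bonds: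
`½ Σ_{x∼x'} Σ_{τ_x ≠ τ_{x'}} b(τ) b(τ∘swap) ≤ ½(ΣΣ[∼])Σb²` (`commW_le`).  On the torus `ΣΣ[∼] ≤ 4L²`, so for unit `b`:
`W⁺ + W⁻ ≤ 4L²` and **`ladderExcessBound_holds : LadderExcessBound`**.
-/

set_option linter.dupNamespace false
set_option autoImplicit false

noncomputable section

open Finset Filter Topology
open Literature.MathematicalPhysics.QuantumLattice Literature.Probability.LatticeModels
open Summit.HubbardSuperconductivity.HubbardSuperconductivity.Theorems.AnisotropyChord.InsertionEntropy
open Summit.HubbardSuperconductivity.HubbardSuperconductivity.Theorems.AnisotropyChord.Tower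
open Summit.HubbardSuperconductivity.HubbardSuperconductivity.Theorems.AnisotropyChord

namespace Summit.HubbardSuperconductivity.HubbardSuperconductivity.Theorems.AnisotropyChord.Transfer

section General

variable {V : Type} [Fintype V] [DecidableEq V] (G : SimpleGraph V) [DecidableRel G.Adj]

/-! ### The involution `τ ↦ τ ∘ swap x x'` and the bound -/

/-- how the local field at `x` changes under swapping the values at `x` and `x'`. [folklore] -/
theorem hloc_comp_swap (τ : V → Fin 2) {x x' : V} (hxx : x ≠ x') :
    hloc G (τ ∘ ⇑(Equiv.swap x x')) x = hloc G τ x + (if G.Adj x x' then sz τ x - sz τ x' else 0) := by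
  unfold hloc
  have hdiff : ∑ y, ((if G.Adj x y then sz (τ ∘ ⇑(Equiv.swap x x')) y else 0) - (if G.Adj x y then sz τ y else 0))
      = (if G.Adj x x' then sz τ x - sz τ x' else 0) := by
    rw [Finset.sum_eq_single x']
    · by_cases h : G.Adj x x'
      · simp [h, sz, Equiv.swap_apply_right]
      · simp [h]
    · intro y _ hy
      by_cases hyx : y = x
      · subst hyx; simp
      · simp [sz, Function.comp, Equiv.swap_apply_of_ne_of_ne hyx hy]
    · intro h; exact absurd (Finset.mem_univ x') h
  rw [← hdiff, Finset.sum_sub_distrib]; ring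

/-- the off-diagonal summand of `W⁺ + W⁻` at the ordered pair `(x, x')`. [folklore] -/
def offTerm (b : (V → Fin 2) → ℝ) (x x' : V) (τ : V → Fin 2) : ℝ :=
  (if x' ≠ x ∧ τ x = 1 ∧ τ x' = 0 then hloc G τ x * (b τ * b (τ ∘ ⇑(Equiv.swap x x'))) else 0)
    + (if x' ≠ x ∧ τ x = 0 ∧ τ x' = 1 then -(hloc G τ x * (b τ * b (τ ∘ ⇑(Equiv.swap x x')))) else 0)

/-- **pointwise symmetrisation:** `g(τ) + g(τ ∘ swap) = [x ∼ x'][τ_x ≠ τ_{x'}]·b(τ)b(τ∘swap)`. [folklore] -/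
theorem offTerm_add_swap (b : (V → Fin 2) → ℝ) {x x' : V} (hxx : x ≠ x') (τ : V → Fin 2) :
    offTerm G b x x' τ + offTerm G b x x' (τ ∘ ⇑(Equiv.swap x x'))
      = if G.Adj x x' ∧ τ x ≠ τ x' then b τ * b (τ ∘ ⇑(Equiv.swap x x')) else 0 := by
  have hss : (τ ∘ ⇑(Equiv.swap x x')) ∘ ⇑(Equiv.swap x x') = τ := by
    funext z; simp [Function.comp, Equiv.swap_apply_self]
  have hx1 : (τ ∘ ⇑(Equiv.swap x x')) x = τ x' := by simp [Equiv.swap_apply_left]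
  have hx2 : (τ ∘ ⇑(Equiv.swap x x')) x' = τ x := by simp [Equiv.swap_apply_right]
  have hh := hloc_comp_swap G τ hxx
  unfold offTerm
  rw [hss, hx1, hx2, hh]
  have hx'x : x' ≠ x := Ne.symm hxx
  rcases Fin.exists_fin_two.mp ⟨τ x, rfl⟩ with h0 | h0 <;>
    rcases Fin.exists_fin_two.mp ⟨τ x', rfl⟩ with h1 | h1 <;>
    simp [h0, h1, hx'x, sz] <;> split_ifs <;> ring

/-- the off-diagonal pair sum is at most `½[x ∼ x']·Σ b²`. [folklore] -/
theorem sum_offTerm_le (b : (V → Fin 2) → ℝ) (x x' : V) :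
    ∑ τ, offTerm G b x x' τ ≤ (1/2 : ℝ) * (if G.Adj x x' then (1:ℝ) else 0) * ∑ τ, b τ ^ 2 := by
  by_cases hxx : x = x'
  · subst hxx
    have : ∀ τ, offTerm G b x x τ = 0 := by intro τ; unfold offTerm; simp
    simp only [this, Finset.sum_const_zero]
    have h0 : 0 ≤ ∑ τ, b τ ^ 2 := Finset.sum_nonneg fun τ _ => sq_nonneg _
    split_ifs <;> nlinarith
  · have hsym : ∑ τ, offTerm G b x x' τ = ∑ τ, offTerm G b x x' (τ ∘ ⇑(Equiv.swap x x')) :=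
      (sum_config_comp_equiv (Equiv.swap x x') (offTerm G b x x')).symm
    have h2 : 2 * ∑ τ, offTerm G b x x' τ
        = ∑ τ, (if G.Adj x x' ∧ τ x ≠ τ x' then b τ * b (τ ∘ ⇑(Equiv.swap x x')) else 0) := by
      rw [two_mul]
      nth_rewrite 2 [hsym]
      rw [← Finset.sum_add_distrib]
      exact Finset.sum_congr rfl fun τ _ => offTerm_add_swap G b hxx τ
    have hbd : ∑ τ, (if G.Adj x x' ∧ τ x ≠ τ x' then b τ * b (τ ∘ ⇑(Equiv.swap x x')) else 0)
        ≤ (if G.Adj x x' then (1:ℝ) else 0) * ∑ τ, b τ ^ 2 := by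
      have hsq : ∑ τ, b (τ ∘ ⇑(Equiv.swap x x')) ^ 2 = ∑ τ, b τ ^ 2 :=
        sum_config_comp_equiv (Equiv.swap x x') (fun τ => b τ ^ 2)
      calc ∑ τ, (if G.Adj x x' ∧ τ x ≠ τ x' then b τ * b (τ ∘ ⇑(Equiv.swap x x')) else 0)
          ≤ ∑ τ, (if G.Adj x x' then (1:ℝ) else 0) * ((b τ ^ 2 + b (τ ∘ ⇑(Equiv.swap x x')) ^ 2) / 2) := by
            apply Finset.sum_le_sum; intro τ _
            by_cases ha : G.Adj x x'
            · by_cases hne : τ x ≠ τ x'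
              · rw [if_pos ⟨ha, hne⟩, if_pos ha]
                nlinarith [sq_nonneg (b τ - b (τ ∘ ⇑(Equiv.swap x x')))]
              · rw [if_neg (fun h => hne h.2), if_pos ha]; positivity
            · rw [if_neg (fun h => ha h.1), if_neg ha]; simp
        _ = (if G.Adj x x' then (1:ℝ) else 0) * ∑ τ, b τ ^ 2 := by
            rw [← Finset.mul_sum]
            have : ∑ τ, (b τ ^ 2 + b (τ ∘ ⇑(Equiv.swap x x')) ^ 2) / 2 = ∑ τ, b τ ^ 2 := by
              rw [← Finset.sum_div, Finset.sum_add_distrib, hsq]; ring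
            rw [this]
    linarith

/-- **THE DOUBLE-COMMUTATOR BOUND: `W⁺(b) + W⁻(b) ≤ (Σ_x Σ_y [x ∼ y])·Σ b²`.**
[conjecture: theory seat hubbard-h0-rotor-theory-1, cycle 12 — LEMMA E core (`⟨a, D a⟩ ≤ 2|E_b|`); Lean proof here] -/
theorem commW_le (b : (V → Fin 2) → ℝ) :
    raiseCommW G b + lowerCommW G b ≤ adjCount G * ∑ τ, b τ ^ 2 := by
  rw [raiseCommW_eq, lowerCommW_eq]
  have hb2 : 0 ≤ ∑ τ, b τ ^ 2 := Finset.sum_nonneg fun τ _ => sq_nonneg _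
  -- diagonal part = −4 Σ b² W ≤ ½·adjCount·Σb²
  have hdiag : ∑ τ, b τ ^ 2 * ∑ x, (if τ x = 1 then hloc G τ x else 0)
      + ∑ σ, (-(b σ ^ 2 * ∑ x, (if σ x = 0 then hloc G σ x else 0)))
      ≤ (1/2 : ℝ) * adjCount G * ∑ τ, b τ ^ 2 := by
    rw [← Finset.sum_add_distrib]
    have hpt : ∀ τ, b τ ^ 2 * ∑ x, (if τ x = 1 then hloc G τ x else 0)
        + -(b τ ^ 2 * ∑ x, (if τ x = 0 then hloc G τ x else 0)) = -4 * (b τ ^ 2 * isingW G τ) := by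
      intro τ
      have e : ∑ x, (if τ x = 1 then hloc G τ x else 0) - ∑ x, (if τ x = 0 then hloc G τ x else 0)
          = -2 * ∑ x, hloc G τ x * sz τ x := by
        rw [← Finset.sum_sub_distrib, Finset.mul_sum]
        refine Finset.sum_congr rfl fun x _ => ?_
        unfold sz
        rcases Fin.exists_fin_two.mp ⟨τ x, rfl⟩ with h | h <;> simp [h] <;> ring
      rw [sum_hloc_mul_sz] at e
      rw [← sub_eq_add_neg, ← mul_sub, e]; ring
    rw [Finset.sum_congr rfl (fun τ _ => hpt τ)]
    have hW : ∀ τ, -4 * (b τ ^ 2 * isingW G τ) ≤ (1/2 : ℝ) * adjCount G * b τ ^ 2 := by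
      intro τ
      have h := abs_isingW_le G τ
      unfold adjCount
      have hb : 0 ≤ b τ ^ 2 := sq_nonneg _
      have : -isingW G τ ≤ (1/8 : ℝ) * ∑ x, ∑ y, if G.Adj x y then (1:ℝ) else 0 := le_trans (neg_le_abs _) h
      nlinarith
    calc ∑ τ, -4 * (b τ ^ 2 * isingW G τ) ≤ ∑ τ, (1/2 : ℝ) * adjCount G * b τ ^ 2 :=
          Finset.sum_le_sum fun τ _ => hW τ
      _ = (1/2 : ℝ) * adjCount G * ∑ τ, b τ ^ 2 := by rw [← Finset.mul_sum]
  -- off-diagonal part ≤ ½·adjCount·Σb²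
  have hoff : ∑ τ, ∑ x, ∑ x', (if x' ≠ x ∧ τ x = 1 ∧ τ x' = 0
        then hloc G τ x * (b τ * b (τ ∘ ⇑(Equiv.swap x x'))) else 0)
      + ∑ σ, ∑ x, ∑ x', (if x' ≠ x ∧ σ x = 0 ∧ σ x' = 1
        then -(hloc G σ x * (b σ * b (σ ∘ ⇑(Equiv.swap x x')))) else 0)
      ≤ (1/2 : ℝ) * adjCount G * ∑ τ, b τ ^ 2 := by
    have e : ∑ τ, ∑ x, ∑ x', (if x' ≠ x ∧ τ x = 1 ∧ τ x' = 0
          then hloc G τ x * (b τ * b (τ ∘ ⇑(Equiv.swap x x'))) else 0)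
        + ∑ σ, ∑ x, ∑ x', (if x' ≠ x ∧ σ x = 0 ∧ σ x' = 1
          then -(hloc G σ x * (b σ * b (σ ∘ ⇑(Equiv.swap x x')))) else 0)
        = ∑ x, ∑ x', ∑ τ, offTerm G b x x' τ := by
      rw [← Finset.sum_add_distrib]
      have e1 : ∀ τ : V → Fin 2, (∑ x, ∑ x', (if x' ≠ x ∧ τ x = 1 ∧ τ x' = 0
            then hloc G τ x * (b τ * b (τ ∘ ⇑(Equiv.swap x x'))) else 0))
          + (∑ x, ∑ x', (if x' ≠ x ∧ τ x = 0 ∧ τ x' = 1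
            then -(hloc G τ x * (b τ * b (τ ∘ ⇑(Equiv.swap x x')))) else 0))
          = ∑ x, ∑ x', offTerm G b x x' τ := by
        intro τ
        rw [← Finset.sum_add_distrib]
        refine Finset.sum_congr rfl fun x _ => ?_
        rw [← Finset.sum_add_distrib]
        rfl
      rw [Finset.sum_congr rfl (fun τ _ => e1 τ), Finset.sum_comm]
      refine Finset.sum_congr rfl fun x _ => ?_
      rw [Finset.sum_comm]
    rw [e]
    calc ∑ x, ∑ x', ∑ τ, offTerm G b x x' τ
        ≤ ∑ x, ∑ x', (1/2 : ℝ) * (if G.Adj x x' then (1:ℝ) else 0) * ∑ τ, b τ ^ 2 :=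
          Finset.sum_le_sum fun x _ => Finset.sum_le_sum fun x' _ => sum_offTerm_le G b x x'
      _ = (1/2 : ℝ) * adjCount G * ∑ τ, b τ ^ 2 := by
          have key : ∀ c : ℝ, ∑ x, ∑ x', (1/2 : ℝ) * (if G.Adj x x' then (1:ℝ) else 0) * c
              = (1/2 : ℝ) * adjCount G * c := by
            intro c
            unfold adjCount
            rw [Finset.mul_sum, Finset.sum_mul]
            refine Finset.sum_congr rfl fun x _ => ?_
            rw [Finset.mul_sum, Finset.sum_mul]
          exact key _
  linarith


end General

section Torus

variable {L : ℕ} [NeZero L]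

/-- every vertex of the torus graph `(ℤ/L)²` has at most `4` neighbours. [folklore] -/
theorem torus_degree_le_four (x : TorusSite 2 L) :
    (∑ y, if (torusGraph 2 L).Adj x y then (1:ℝ) else 0) ≤ 4 := by
  classical
  set S : Finset (TorusSite 2 L) :=
    {x + Pi.single 0 1, x - Pi.single 0 1, x + Pi.single 1 1, x - Pi.single 1 1} with hS
  have hsub : (univ.filter fun y => (torusGraph 2 L).Adj x y) ⊆ S := by
    intro y hy
    rw [Finset.mem_filter] at hy
    have h := (torusGraph_adj_iff x y).1 hy.2
    obtain ⟨_, h | h⟩ := h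
    · obtain ⟨i, hi⟩ := h
      fin_cases i <;> simp [hS, hi]
    · obtain ⟨i, hi⟩ := h
      have hy' : y = x - Pi.single i 1 := by rw [hi]; simp
      fin_cases i <;> simp [hS, hy']
  have hcardS : S.card ≤ 4 := by
    rw [hS]
    refine (Finset.card_insert_le _ _).trans ?_
    refine (Nat.succ_le_succ (Finset.card_insert_le _ _)).trans ?_
    refine (Nat.succ_le_succ (Nat.succ_le_succ (Finset.card_insert_le _ _))).trans ?_
    simp
  have hcard : (univ.filter fun y => (torusGraph 2 L).Adj x y).card ≤ 4 :=
    (Finset.card_le_card hsub).trans hcardS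
  have e : (∑ y, if (torusGraph 2 L).Adj x y then (1:ℝ) else 0)
      = ((univ.filter fun y => (torusGraph 2 L).Adj x y).card : ℝ) := by
    rw [Finset.card_filter]; push_cast; rfl
  rw [e]; exact_mod_cast hcard

/-- `Σ_x Σ_y [x ∼ y] ≤ 4L²` on the torus. [folklore] -/
theorem adjCount_torus_le : adjCount (torusGraph 2 L) ≤ 4 * (L : ℝ) ^ 2 := by
  unfold adjCount
  have hcard : (Fintype.card (TorusSite 2 L) : ℝ) = (L : ℝ) ^ 2 := by
    rw [Fintype.card_fun, ZMod.card, Fintype.card_fin]; push_cast; ring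
  calc ∑ x : TorusSite 2 L, ∑ y, (if (torusGraph 2 L).Adj x y then (1:ℝ) else 0)
      ≤ ∑ _x : TorusSite 2 L, (4 : ℝ) := Finset.sum_le_sum fun x _ => torus_degree_le_four x
    _ = 4 * (L : ℝ) ^ 2 := by rw [Finset.sum_const, Finset.card_univ, nsmul_eq_mul, hcard]; ring

/-- **LEMMA E HOLDS: `LadderExcessBound`** (the theory seat's ladder excess bound, THEOREM-T.md; Koma–Tasaki double commutator
`⟨S⁺a,[H,S⁺]a⟩ + ⟨S⁻a,[H,S⁻]a⟩ = (1−Δ)⟨a, D a⟩ ≤ (1−Δ)·2|E_b|`).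
[conjecture: theory seat hubbard-h0-rotor-theory-1, cycle 12, memo §175 — LEMMA E; Lean proof here] -/
theorem ladderExcessBound_holds : LadderExcessBound :=
  ladderExcessBound_of_commutatorBound fun L _ Δ M a ha =>
    (commW_le (torusGraph 2 L) a).trans (by
      rw [ha.unit, mul_one]; exact adjCount_torus_le)

/-- **THEOREM T with LEMMA E discharged:** for `0 ≤ Δ < 1`, KLS anchor (H1) + symmetric `z = 1` sector gap (H2) + (H3)
⇒ `CondensateOnFirstSectors Δ k` (BEC of hard-core bosons on `(ℤ/L)²` in each sector `N = L²/2 + j`, `j ≤ k`).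
[conjecture: theory seat hubbard-h0-rotor-theory-1, cycle 12 — CONDITIONAL RUNG T, now conditional on (H2), (H3) only; Lean proof here] -/
theorem condensateOnFirstSectors_of_gap {Δ c₀ c₁ : ℝ} {k : ℕ} (hΔ0 : 0 ≤ Δ) (hΔ1 : Δ < 1)
    (hc₀ : 0 < c₀) (hc₁ : 0 < c₁) (hA : HalfFillingAnchor Δ c₀) (hGap : SymmetricSectorGap Δ c₁ (k + 1))
    (hGlob : SectorZeroGlobalGround Δ) : CondensateOnFirstSectors Δ k :=
  condensateOnFirstSectors_of_hypotheses hΔ0 hΔ1 hc₀ hc₁ hA hGap hGlob ladderExcessBound_holds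

end Torus

end Summit.HubbardSuperconductivity.HubbardSuperconductivity.Theorems.AnisotropyChord.Transfer
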